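import Summits.Ventures.YMGap.Conjectures.StrongCouplingChiralLROMesonWeightBackgroundN
import Literature.MathematicalPhysics.QuantumLattice.StaggeredGaugeGaussianCorrectedRPOfHermitianSquares
import HarnessLib
import HarnessLib.Audit.Tags

/-!
# Row S3 of Y3 beyond `β = 0`, general `N` (2/3): the background weight of the `U(N)` theory is a
# reflection-positive weight for the time plane at every `β ≥ 0`, given a one-link certificate

Cell `pub-ymgap`, seat qcd-lit g22 (literature-prover), `bears_on: Q1`.  Everything is a theorem
(0 facts, 0 sorry).  Continuation of `…MesonWeightBackgroundN`, the `N`-colour version of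
`…MesonWeightTimePlane`:

* `bos_bondTermN`: the bosonised bond factor is `e^{−(1/4N) ψ̄ψ(x)ψ̄ψ(y)}`, so the bosonised crossing part
  of the background weight IS the inverse crossing Gaussian `gaussCorrN (1/4N)` of
  `StaggeredGaugeGaussianCorrectedRPOfHermitianSquares` (`bos_crossBondN`);
* `bracketW_bgWeightN_mul_reflect`: `[A·ΘA]_{W^{bg,ε}_β} = s·J_β(gaussCorrN · â Θâ)` with
  `â = (A S₊ B₊)^` a positive-time fermion polynomial;
* **`isRPWeight_bgWeightN_zero_one`**: given a hermitian-square certificate `HermSqCert N (1/4N) J`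
  (Salmhofer–Seiler's Remark 4.5 at `β > 0` in matrix form; for `N = 2` it is `hermSqCert_two`), the
  background weight `W^{bg,ε}_β` is an `IsRPWeight` for the plane `(0, 1)` at every `β ≥ 0`, both twists.

Honest framing: finite even torus, `β ≥ 0`; nothing about the continuum or the summit's `QCD` conjunct.

## References
* [SalmhoferSeiler1991] M. Salmhofer, E. Seiler, Commun. Math. Phys. 139 (1991) 395–432, Remark 3.2,
  Remark 4.5, (3.78), (3.84)–(3.90).
* [FrohlichIsraelLiebSimon1978] J. Fröhlich, R. Israel, E. H. Lieb, B. Simon, Commun. Math. Phys. 62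
  (1978) 1–34, §2.
-/

noncomputable section

open MeasureTheory Finset MvPolynomial
open scoped ComplexConjugate BigOperators ComplexOrder
open Literature.MathematicalPhysics.QuantumFieldTheory (Site Edge GaugeConfig Site.timeReflect)
open Literature.MathematicalPhysics.QuantumFieldTheory.WilsonRP
open Literature.MathematicalPhysics.QuantumLattice
open Literature.MathematicalPhysics.QuantumLattice.GrassmannAlgebra
open Literature.MathematicalPhysics.QuantumLattice.StrongCoupling
open Literature.MathematicalPhysics.QuantumLattice.StaggeredRP (definingRep thetaT posAlg posSites IsPosSite
  gaussCorrN gaussTermN HermSqCert)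
open Literature.MathematicalPhysics.StatisticalMechanics
open Literature.MathematicalPhysics.StatisticalMechanics.ComplexSpin
open Literature.Barriers.CriticalPhenomena.NonGibbs
open Literature.Probability.LatticeModels (TorusSite)

namespace Summit.Ventures.YMGap.Conjectures

namespace MesonWeight

open SchwingerDyson

variable {N ν L : ℕ} [NeZero L] [LinearOrder (TorusSite ν L)]

/-! ### The bosonised bond factor is the inverse Gaussian `e^{−(1/4N)ψ̄ψψ̄ψ}` -/

omit [NeZero L] in
/-- `bos (−N σ_xσ_y) = −(1/4N) ψ̄ψ(x)ψ̄ψ(y)` (`σ̂ = ψ̄ψ/2N`). [cite: SalmhoferSeiler1991, §2 (2.20)–(2.21)] -/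
theorem bos_bondExponent (hN : N ≠ 0) (x y : TorusSite ν L) :
    bos N (C (-((N : ℕ) : ℂ)) * (X x * X y) ^ 1 : MvPolynomial (TorusSite ν L) ℂ) =
      -(((1 / (4 * N) : ℝ)) : ℂ) • (meson x * meson y : FermiAlg (TorusSite ν L) N) := by
  rw [pow_one, bos_mul, bos_C, bos_mul, bos_X, bos_X, ← Algebra.smul_def, smul_mul_smul_comm, smul_smul]
  congr 1
  have hN' : (N : ℂ) ≠ 0 := Nat.cast_ne_zero.2 hN
  unfold spinScale
  push_cast
  field_simp
  ring

omit [NeZero L] in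
/-- Powers of `ψ̄ψ(x)ψ̄ψ(y)` beyond `N` vanish. [cite: SalmhoferSeiler1991, §2 (2.20)] -/
theorem meson_mul_meson_pow_eq_zero (x y : TorusSite ν L) {n : ℕ} (hn : N < n) :
    (meson x * meson y : FermiAlg (TorusSite ν L) N) ^ n = 0 := by
  rw [(commute_meson x _).mul_pow, meson_pow_eq_zero x hn, zero_mul]

/-- **`bos e_D^{−Nσ_xσ_y} = e^{−(1/4N) ψ̄ψ(x)ψ̄ψ(y)}`**: both are the exponential series truncated at the
`N`-th power. [cite: SalmhoferSeiler1991, §2 (2.20) and Remark 4.5] -/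
theorem bos_bondTermN (hN : N ≠ 0) (x y : TorusSite ν L) :
    bos N (bondTermN N x y) = grassmannExp (-(((1 / (4 * N) : ℝ)) : ℂ) • (meson x * meson y : FermiAlg (TorusSite ν L) N)) := by
  set w : FermiAlg (TorusSite ν L) N := -(((1 / (4 * N) : ℝ)) : ℂ) • (meson x * meson y) with hw
  have hwpow : ∀ n, N < n → w ^ n = 0 := fun n hn => by rw [hw, smul_pow, meson_mul_meson_pow_eq_zero x y hn, smul_zero]
  have hND : N + 1 ≤ topDegree ν L N + 1 := by
    rw [topDegree]
    exact Nat.succ_le_succ (Nat.le_mul_of_pos_right N Fintype.card_pos)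
  rw [grassmannExp_eq_sum (hwpow (N + 1) (Nat.lt_succ_self N)), bondTermN, eT, bos_sum]
  simp_rw [bos_mul, bos_C, bos_pow, bos_bondExponent hN, ← Algebra.smul_def]
  rw [← hw]
  symm
  refine Finset.sum_subset (Finset.range_subset_range.2 hND) fun n hn hn' => ?_
  rw [Finset.mem_range, not_lt] at hn'
  rw [hwpow n (by omega), smul_zero]

variable [NeZero ν]

/-- **The bosonised crossing part of the background weight is the inverse crossing Gaussian** of
`StaggeredGaugeGaussianCorrectedRPOfHermitianSquares` at `κ = 1/4N`. [cite: SalmhoferSeiler1991, Remark 4.5] -/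
theorem bos_crossBondN (hN : N ≠ 0) : bos N (crossBondN N ν L) = gaussCorrN ν L N (1 / (4 * N)) := by
  classical
  rw [crossBondN, bos_finset_prod, gaussCorrN,
    StrongCoupling.grassmannExp_sum_of_mem_evenOdd_zero crossEdges (fun e : Edge ν L => gaussTermN (N := N) (1 / (4 * N)) e)
      (StaggeredRP.gaussTermN_mem_evenOdd_zero _) (StaggeredRP.isNilpotent_gaussTermN _)]
  exact Finset.noncommProd_congr rfl (fun e _ => bos_bondTermN hN e.1 _) _

/-! ### Gaussian-corrected reflection positivity through the dictionary -/

/-- **The core positivity** (`β ≥ 0`, a certificate at `κ = 1/4N`): `s · J_β(gaussCorrN · a Θ̂a) ≥ 0` for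
every positive-time fermion polynomial `a`. [cite: SalmhoferSeiler1991, Remark 4.5] -/
theorem chiralSign_mul_sdJ_gaussCorrN_nonneg {J : Type} [Fintype J] (cert : HermSqCert N (1 / (4 * N)) J)
    (hL : Even L) {β : ℝ} (hβ : 0 ≤ β) {a : FermiAlg (TorusSite ν L) N} (ha : a ∈ posAlg N (posSites : Finset (TorusSite ν L))) :
    0 ≤ chiralSign (N := N) (evens ν L) * sdJ N ν L β (gaussCorrN ν L N (1 / (4 * N)) * (a * thetaT a)) := by
  haveI : Fact (1 < L) := ⟨StaggeredRP.one_lt_of_even_neZero hL⟩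
  have h := StaggeredRP.gaussCorrectedN_reflection_positivity (definingRep N) cert hL StaggeredRP.continuous_definingRep hβ 0
    (StaggeredRP.isPosObservable_const (G := UN N) ha)
  have h' : 0 ≤ StaggeredRP.expect (definingRep N) β 0
      (fun _ : GaugeConfig ν L (UN N) => gaussCorrN ν L N (1 / (4 * N)) * (a * thetaT a)) := by
    simpa only [StaggeredRP.thetaObs] using h
  exact chiralSign_mul_sdJ_nonneg_of_expect hL β h'

/-- **The RP bracket of the background weight through the dictionary**:
`[A·ΘA]_{W^{bg,ε}_β} = s·J_β(gaussCorrN · (A S₊ B₊)^ Θ̂(A S₊ B₊)^)`. [cite: SalmhoferSeiler1991, (3.84)–(3.90) and Remark 4.5] -/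
theorem bracketW_bgWeightN_mul_reflect (hN : N ≠ 0) (hL : Even L) (ε : ℤ) (β : ℝ) (A : FieldAlg ν L) :
    bracketW N (bgWeightN N ν L ε β) (A * reflect (0 : Fin ν) 1 A) =
      chiralSign (N := N) (evens ν L) * sdJ N ν L β
        (gaussCorrN ν L N (1 / (4 * N)) *
          (bos N (A * posSiteN N ν L ε * posBondN N ν L) * thetaT (bos N (A * posSiteN N ν L ε * posBondN N ν L)))) := by
  rw [bgWeightN, bracketW_mul_weight, bracketW_mesonWeightC hL, bondFactorN_split hL, siteFactorN_split hL ε,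
    show A * reflect (0 : Fin ν) 1 A * (posSiteN N ν L ε * reflect (0 : Fin ν) 1 (posSiteN N ν L ε) *
        (posBondN N ν L * reflect (0 : Fin ν) 1 (posBondN N ν L) * crossBondN N ν L)) =
      A * posSiteN N ν L ε * posBondN N ν L * reflect (0 : Fin ν) 1 (A * posSiteN N ν L ε * posBondN N ν L) *
        crossBondN N ν L by rw [map_mul, map_mul]; ring,
    bos_mul, bos_mul, bos_crossBondN hN, ((commute_bos _ _).mul_left (commute_bos _ _)).eq, bos_reflect_zero_one]

/-- **THE BACKGROUND WEIGHT OF THE `U(N)` THEORY IS A REFLECTION-POSITIVE WEIGHT FOR THE TIME PLANE, AT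
EVERY `β ≥ 0`, BOTH TWISTS**, given a hermitian-square certificate at `κ = 1/4N` — Salmhofer–Seiler's
Remark 4.5 beyond `β = 0`, in the form consumed by the Gaussian-domination files. [cite: SalmhoferSeiler1991, Remark 4.5 and (3.84)–(3.90)] -/
theorem isRPWeight_bgWeightN_zero_one {J : Type} [Fintype J] (cert : HermSqCert N (1 / (4 * N)) J) (hN : N ≠ 0)
    (hL : Even L) {β : ℝ} (hβ : 0 ≤ β) (ε : ℤ) :
    IsRPWeight (0 : Fin ν) 1 N (bgWeightN N ν L ε β) := by
  refine ⟨reflect_bgWeightN hL hβ ε, fun {A} hA => ?_⟩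
  have hmem : A * posSiteN N ν L ε * posBondN N ν L ∈ plusAlgebra (0 : Fin ν) 1 :=
    Subalgebra.mul_mem _ (Subalgebra.mul_mem _ hA (posSiteN_mem ε)) (posBondN_mem hL)
  have hpos := chiralSign_mul_sdJ_gaussCorrN_nonneg cert hL hβ (bos_mem_posAlg (N := N) hL hmem)
  rw [← bracketW_bgWeightN_mul_reflect hN hL ε β A] at hpos
  obtain ⟨hre, him⟩ := Complex.nonneg_iff.1 hpos
  exact ⟨Complex.ext (by simp) (by simp [← him]), hre⟩

end MesonWeight

end Summit.Ventures.YMGap.Conjectures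

end
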